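import Literature.Probability.Percolation.DecisionTreeWeighted
import Mathlib.Data.Fintype.Prod
import HarnessLib

/-!
# The decision-tree van den Berg–Kesten inequality for DECREASING events (closed witnesses)

builds on p205010 (kernel theorem, internal audit signed; external expert review pending)

PAPER-2 track "percolation constants", part (ii), seat `prim-consts-1`, gen 17 (lane index
`run/shared/lean/prim/consts/CONSTANTS.md`, row A19; memo `FROM-prim-consts-1-g17-THREE-COPY-STRUCTURE.md` §0(6)).
Support file for the crux `NoHeavyLowerTail` (stmt-CriticalPhenomena-4575; `--supports`).  Theorems only (no definitions,
no sorries).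

Gladkov's Theorem 4.3 (tree `DecisionTree.Pr2W_treeDsq_le`, `DecisionTreeWeighted.lean`) is stated for INCREASING events
`A, B` presented by open witnesses: `P(A □_S B) ≤ P(A) P(B)` where `S = S(C₁)` is the set built by a decision tree `T` reading the
first configuration, and `(C₁, C₂) ∈ A □_S B` means that there are `I ⊆ C₁` with `I ∈ A` and `J ⊆ C₁ →_S C₂` with `J ∈ B` such that
`I ∩ J ∩ S = ∅`.  The cluster-square inequality of this track concerns the DECREASING event `{b ↮ c}`, whose witnesses are sets of
CLOSED pairs (cuts).  This file transports Theorem 4.3 through the complementation `C ↦ Cᶜ` (which exchanges the weights `p` and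
`1 − p` and turns the tree `T` into its mirror image):

* `Consts.ClosedBK.exists_mirror` — the tree with the two children of every node exchanged builds, on `Cᶜ`, the set
  that `T` builds on `C`;
* `wtW_compl`, `PrW_compl`, `Pr2W_compl`, `splice_compl` — complementation exchanges `p ↔ 1 − p` and commutes with splicing;
* **`Consts.ClosedBK.Pr2W_closedWitness_le`** — disjoint occurrence with CLOSED witnesses: for lower sets `A, B` and any
  tree `T`, the probability that there are `I` disjoint from `C₁` with `Iᶜ ∈ A` (closing the pairs of `I` forces `A` whatever the
  other pairs do), `J` disjoint from `C₁ →_S C₂` with `Jᶜ ∈ B`, and `I ∩ J ∩ S(C₁) = ∅`, is at most `P(A) · P(B)`.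

Reference: N. Gladkov, *Percolation Inequalities and Decision Trees*, arXiv:2408.08457v2 (2024), Def. 4.2, Thm. 4.3
(and the remark that the statement for decreasing events follows by symmetry).
-/

noncomputable section

open Classical

namespace Summit.CriticalPhenomena.PercolationContinuityZ3.Theorems

namespace Consts

namespace ClosedBK

open Finset Literature.Probability.Percolation Literature.Probability.Percolation.DecisionTree

variable {ι : Type*} [Fintype ι] [DecidableEq ι]

/-! ### The mirrored tree -/

/-- **A mirrored tree exists**: for every decision tree `T` there is a tree (the same queries with the two children of every
node exchanged) that builds on the complement `Cᶜ` the set that `T` builds on `C`. [cite: Gladkov2024, Def. 2.4] -/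
theorem exists_mirror : ∀ T : DTree ι, ∃ T' : DTree ι, ∀ S : Finset ι, revealed T' Sᶜ = revealed T S
  | .leaf => ⟨.leaf, fun _ => rfl⟩
  | .node e yes no => by
      obtain ⟨yes', hyes⟩ := exists_mirror yes
      obtain ⟨no', hno⟩ := exists_mirror no
      refine ⟨.node e no' yes', fun S => ?_⟩
      simp only [revealed, Finset.mem_compl]
      by_cases he : e ∈ S
      · rw [if_neg (not_not.2 he), if_pos he, hyes S]
      · rw [if_pos he, if_neg he, hno S]

/-! ### Complementation exchanges `p` and `1 - p` -/

/-- `wtW_{1-p}(Sᶜ) = wtW_p(S)` over all coordinates. [folklore] -/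
theorem wtW_compl (p : ι → ℝ) (S : Finset ι) :
    wtW Finset.univ (fun i => 1 - p i) Sᶜ = wtW Finset.univ p S := by
  unfold wtW
  refine Finset.prod_congr rfl fun i _ => ?_
  by_cases hi : i ∈ S
  · rw [if_neg (fun h => (Finset.mem_compl.1 h) hi), if_pos hi, sub_sub_cancel]
  · rw [if_pos (Finset.mem_compl.2 hi), if_neg hi]

/-- `wt2W_{1-p}(S₁ᶜ, S₂ᶜ) = wt2W_p(S₁, S₂)`. [folklore] -/
theorem wt2W_compl (p : ι → ℝ) (x : Finset ι × Finset ι) :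
    wt2W Finset.univ (fun i => 1 - p i) (x.1ᶜ, x.2ᶜ) = wt2W Finset.univ p x := by
  unfold wt2W
  rw [wtW_compl, wtW_compl]

/-- `P_p{C : Cᶜ ∈ X} = P_{1-p}(X)`. [folklore] -/
theorem PrW_compl (p : ι → ℝ) (X : Set (Finset ι)) :
    PrW Finset.univ p {S | Sᶜ ∈ X} = PrW Finset.univ (fun i => 1 - p i) X := by
  unfold PrW
  rw [Finset.powerset_univ]
  symm
  refine Fintype.sum_bijective (fun S : Finset ι => Sᶜ) compl_bijective _ _ fun S => ?_
  have hmem : Sᶜ ∈ {S : Finset ι | Sᶜ ∈ X} ↔ S ∈ X := by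
    show Sᶜᶜ ∈ X ↔ S ∈ X
    rw [compl_compl]
  by_cases hS : S ∈ X
  · rw [Set.indicator_of_mem hS, Set.indicator_of_mem (hmem.2 hS)]
    have h := wtW_compl p Sᶜ
    rw [compl_compl] at h
    exact h
  · rw [Set.indicator_of_notMem hS, Set.indicator_of_notMem (fun h => hS (hmem.1 h))]

/-- `P_p{(C₁, C₂) : (C₁ᶜ, C₂ᶜ) ∈ Y} = P_{1-p}(Y)`. [folklore] -/
theorem Pr2W_compl (p : ι → ℝ) (Y : Set (Finset ι × Finset ι)) :
    Pr2W Finset.univ p {x | (x.1ᶜ, x.2ᶜ) ∈ Y} = Pr2W Finset.univ (fun i => 1 - p i) Y := by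
  unfold Pr2W
  rw [Finset.powerset_univ, Finset.univ_product_univ]
  symm
  have hbij : Function.Bijective (fun x : Finset ι × Finset ι => (x.1ᶜ, x.2ᶜ)) := by
    refine ⟨fun x y h => ?_, fun y => ⟨(y.1ᶜ, y.2ᶜ), by simp⟩⟩
    have h1 := congrArg Prod.fst h
    have h2 := congrArg Prod.snd h
    simp only [compl_inj_iff] at h1 h2
    exact Prod.ext h1 h2
  refine Fintype.sum_bijective _ hbij _ _ fun x => ?_
  have hmem : (x.1ᶜ, x.2ᶜ) ∈ {x : Finset ι × Finset ι | (x.1ᶜ, x.2ᶜ) ∈ Y} ↔ x ∈ Y := by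
    show (x.1ᶜᶜ, x.2ᶜᶜ) ∈ Y ↔ x ∈ Y
    rw [compl_compl, compl_compl]
  by_cases hx : x ∈ Y
  · rw [Set.indicator_of_mem hx, Set.indicator_of_mem (hmem.2 hx)]
    have h := wt2W_compl p (x.1ᶜ, x.2ᶜ)
    simp only [compl_compl] at h
    exact h
  · rw [Set.indicator_of_notMem hx, Set.indicator_of_notMem (fun h => hx (hmem.1 h))]

/-- Complementation commutes with splicing: `(C₁ →_F C₂)ᶜ = C₁ᶜ →_F C₂ᶜ`. [cite: Gladkov2024, Def. 2.3] -/
theorem splice_compl (F S₁ S₂ : Finset ι) : splice F S₁ᶜ S₂ᶜ = (splice F S₁ S₂)ᶜ := by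
  ext i
  simp only [mem_splice, Finset.mem_compl]
  tauto

/-! ### Disjoint occurrence with closed witnesses -/

/-- Complementation turns closed witnesses along `T` into open witnesses (Def. 4.2) along a mirrored tree `T'`.
[cite: Gladkov2024, Def. 4.2] -/
theorem compl_mem_treeDsq_of_closedWitness {T T' : DTree ι} (hT : ∀ S : Finset ι, revealed T' Sᶜ = revealed T S)
    (A B : Set (Finset ι)) {x : Finset ι × Finset ι}
    (hx : ∃ I J : Finset ι, Disjoint I x.1 ∧ Iᶜ ∈ A ∧ Disjoint J (splice (revealed T x.1) x.1 x.2) ∧ Jᶜ ∈ B ∧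
      ∀ i ∈ I, i ∈ J → i ∉ revealed T x.1) :
    (x.1ᶜ, x.2ᶜ) ∈ treeDsq ∅ T' {Z : Finset ι | Zᶜ ∈ A} {Z : Finset ι | Zᶜ ∈ B} := by
  obtain ⟨I, J, hI, hIA, hJ, hJB, hIJ⟩ := hx
  show (x.1ᶜ, x.2ᶜ) ∈ dsqWith (∅ ∪ revealed T' x.1ᶜ) {Z : Finset ι | Zᶜ ∈ A} {Z : Finset ι | Zᶜ ∈ B}
  rw [Finset.empty_union, hT]
  refine ⟨I, J, fun i hi => Finset.mem_compl.2 (Finset.disjoint_left.1 hI hi), ?_, fun i hi => ?_, ?_, hIJ⟩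
  · show Iᶜ ∈ A
    exact hIA
  · show i ∈ splice (revealed T x.1) x.1ᶜ x.2ᶜ
    rw [splice_compl, Finset.mem_compl]
    exact Finset.disjoint_left.1 hJ hi
  · show Jᶜ ∈ B
    exact hJB

/-- The complements of a lower set form an upper set. [folklore] -/
theorem isUpperSet_compl_mem {A : Set (Finset ι)} (hA : IsLowerSet A) : IsUpperSet {Z : Finset ι | Zᶜ ∈ A} := by
  intro Z₁ Z₂ hZ hZA
  have h : Z₂ᶜ ≤ Z₁ᶜ := compl_le_compl hZ
  have hZA' : Z₁ᶜ ∈ A := hZA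
  show Z₂ᶜ ∈ A
  exact hA h hZA'

/-- **Theorem 4.3 for decreasing events (closed witnesses).**  For lower sets `A, B` and any decision tree `T` reading `C₁`:
the probability that there are `I` disjoint from `C₁` with `Iᶜ ∈ A` (closing `I` forces `A`), `J` disjoint from `C₁ →_S C₂` with
`Jᶜ ∈ B`, and `I ∩ J ∩ S = ∅`, where `S = S(C₁)` is the set built by `T`, is at most `P(A) · P(B)`.
[cite: Gladkov2024, Thm. 4.3 (with Def. 4.2); the decreasing form by complementation] -/
theorem Pr2W_closedWitness_le {p : ι → ℝ} (hp0 : ∀ i, 0 ≤ p i) (hp1 : ∀ i, p i ≤ 1) (T : DTree ι)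
    {A B : Set (Finset ι)} (hA : IsLowerSet A) (hB : IsLowerSet B) :
    Pr2W Finset.univ p {x | ∃ I J : Finset ι, Disjoint I x.1 ∧ Iᶜ ∈ A ∧ Disjoint J (splice (revealed T x.1) x.1 x.2) ∧
        Jᶜ ∈ B ∧ ∀ i ∈ I, i ∈ J → i ∉ revealed T x.1} ≤
      PrW Finset.univ p A * PrW Finset.univ p B := by
  obtain ⟨T', hT⟩ := exists_mirror T
  have hq0 : ∀ i, 0 ≤ 1 - p i := fun i => sub_nonneg.2 (hp1 i)
  have hq1 : ∀ i, 1 - p i ≤ 1 := fun i => sub_le_self 1 (hp0 i)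
  have hqp : (fun i => 1 - (1 - p i)) = p := funext fun i => sub_sub_cancel 1 (p i)
  have h1 : Pr2W Finset.univ p {x | ∃ I J : Finset ι, Disjoint I x.1 ∧ Iᶜ ∈ A ∧
        Disjoint J (splice (revealed T x.1) x.1 x.2) ∧ Jᶜ ∈ B ∧ ∀ i ∈ I, i ∈ J → i ∉ revealed T x.1} ≤
      Pr2W Finset.univ p {x | (x.1ᶜ, x.2ᶜ) ∈ treeDsq ∅ T' {Z : Finset ι | Zᶜ ∈ A} {Z : Finset ι | Zᶜ ∈ B}} := by
    refine Pr2W_mono Finset.univ hp0 hp1 ?_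
    intro x _ _ hx
    have h := compl_mem_treeDsq_of_closedWitness hT A B hx
    exact h
  have h2 : Pr2W Finset.univ p {x | (x.1ᶜ, x.2ᶜ) ∈ treeDsq ∅ T' {Z : Finset ι | Zᶜ ∈ A} {Z : Finset ι | Zᶜ ∈ B}} =
      Pr2W Finset.univ (fun i => 1 - p i) (treeDsq ∅ T' {Z : Finset ι | Zᶜ ∈ A} {Z : Finset ι | Zᶜ ∈ B}) := by
    exact Pr2W_compl p _
  have h3 : Pr2W Finset.univ (fun i => 1 - p i) (treeDsq ∅ T' {Z : Finset ι | Zᶜ ∈ A} {Z : Finset ι | Zᶜ ∈ B}) ≤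
      PrW Finset.univ (fun i => 1 - p i) {Z : Finset ι | Zᶜ ∈ A} * PrW Finset.univ (fun i => 1 - p i) {Z : Finset ι | Zᶜ ∈ B} := by
    exact Pr2W_treeDsq_le Finset.univ hq0 hq1 T' (isUpperSet_compl_mem hA) (isUpperSet_compl_mem hB)
  have h4 : PrW Finset.univ (fun i => 1 - p i) {Z : Finset ι | Zᶜ ∈ A} = PrW Finset.univ p A := by
    rw [PrW_compl (fun i => 1 - p i) A, hqp]
  have h5 : PrW Finset.univ (fun i => 1 - p i) {Z : Finset ι | Zᶜ ∈ B} = PrW Finset.univ p B := by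
    rw [PrW_compl (fun i => 1 - p i) B, hqp]
  rw [← h4, ← h5]
  exact h1.trans (h2.le.trans h3)

end ClosedBK

end Consts

end Summit.CriticalPhenomena.PercolationContinuityZ3.Theorems
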